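import Mathlib
import Summits.MatrixMultiplication.MatrixMultiplication.Theorems.SoloBlindTriangleDoubled

/-!
# Solo-blind seat (MatrixMultiplication), s66 — the COVERING THEOREM for doubled triangle families
(Conjecture T△, SHARPEST §2T, TRIANGLE.md (R14)–(R16), CLAIMS c624–c627)

Setting of `SoloBlindTriangleDoubled.lean`: a finite abelian group `H`, `d` zero-sum triangles
`{a_i, b_i, c_i}` (`a_i + b_i + c_i = 0`) each used twice, GOOD = no non-empty rainbow selection
(at most one element per copy) sums to `0`.  THEOREM T△² there: the `3^d` sums over
`E_i = {0, a_i, -b_i}` are distinct rainbow sums, so `|H| ≥ 3^d`.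

New here (elementary, but it is what the exhaustive tables show — every good doubled 4-family in `ℤ/m`,
`m ≤ 161`, is perfect, and no ninth triangle fits below `2·3^4 = 162`):

* `soloBlind_triangleDoubled_covering` — **COVERING THEOREM.**  With the second packing sets
  `E'_i = {0, b_i, -a_i}` one has `E_i + E'_i = {0, ±a_i, ±b_i, ±c_i} ⊆` rainbow sums of the two copies of
  triangle `i`; both `Σ E_i` and `Σ E'_i` are injective (T△² and its `a ↔ b` mirror), so if
  `|H| < 2·3^d` the pigeonhole principle gives `Σ_i E_i + Σ_i E'_i = H`: EVERY element of `H` is a rainbow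
  sum — the family is perfect.
* `soloBlind_triangleDoubled_plus_one_card` — **Conjecture T△ for one simple triangle.**  If a further
  zero-sum triangle `{a', b', c'}` can be adjoined keeping the family good (`n = 2d + 1` triangles), then
  `-a'` is not a rainbow sum of the doubled part, so the doubled part is not perfect and `|H| ≥ 2·3^d`
  (`> 3^{n/2}`; the strong odd form of T△).  The pen version with chains of simple triangles gives
  `|H| ≥ (s+1)·3^d` for `d` doubled and `s ≥ 1` simple triangles, i.e. T△ for all `s ≤ 2` (TRIANGLE.md (R15)).
No `ω` content by itself (door I1⁗ bookkeeping).
-/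

namespace Summit.MatrixMultiplication.MatrixMultiplication.Theorems

open Finset BigOperators

section TriangleCovering

variable {H : Type*} [AddCommGroup H] {d : ℕ}

/-- Relabelling `a ↔ b` of a selection index (`0 ↔ 1`, `2` and `none` fixed). -/
def soloBlindTriSwap (o : Option (Fin 3)) : Option (Fin 3) :=
  o.map ![1, 0, 2]

/-- The value table of the relabelled triangle `(b, a, c)` is the original table composed with the swap. -/
theorem soloBlind_triVal_swap (a b c : Fin d → H) (i : Fin d) (o : Option (Fin 3)) :
    soloBlindTriVal b a c i o = soloBlindTriVal a b c i (soloBlindTriSwap o) := by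
  cases o with
  | none => simp [soloBlindTriVal, soloBlindTriSwap]
  | some x => fin_cases x <;> simp [soloBlindTriVal, soloBlindTriSwap]

omit [AddCommGroup H] in
/-- The swap fixes `none` only at `none`. -/
theorem soloBlind_triSwap_eq_none (o : Option (Fin 3)) (h : soloBlindTriSwap o = none) : o = none := by
  cases o with
  | none => rfl
  | some x => simp [soloBlindTriSwap] at h

/-- Goodness is invariant under the relabelling `a ↔ b` of every triangle. -/
theorem soloBlind_triGood_swap (a b c : Fin d → H)
    (hgood : ∀ s t : Fin d → Option (Fin 3),
      (∑ i, (soloBlindTriVal a b c i (s i) + soloBlindTriVal a b c i (t i))) = 0 →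
        ∀ i, s i = none ∧ t i = none) :
    ∀ s t : Fin d → Option (Fin 3),
      (∑ i, (soloBlindTriVal b a c i (s i) + soloBlindTriVal b a c i (t i))) = 0 →
        ∀ i, s i = none ∧ t i = none := by
  intro s t h i
  simp only [soloBlind_triVal_swap a b c] at h
  have h' := hgood (fun i => soloBlindTriSwap (s i)) (fun i => soloBlindTriSwap (t i)) h i
  exact ⟨soloBlind_triSwap_eq_none _ h'.1, soloBlind_triSwap_eq_none _ h'.2⟩

/-- The covering table: `E_i x + E'_i y` (`E = {0,a,-b}`, `E' = {0,b,-a}`) as a rainbow selection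
`(first copy, second copy)` from the two copies of triangle `i`. -/
def soloBlindTriRep2 (x y : Fin 3) : Option (Fin 3) × Option (Fin 3) :=
  ![![((none : Option (Fin 3)), (none : Option (Fin 3))), (some 1, none), (some 1, some 2)],
    ![(some 0, none), (some 0, some 1), (none, none)],
    ![(some 0, some 2), (none, none), (some 2, none)]] x y

/-- The covering table is correct: its value is `E_i x + E'_i y` (uses only `a_i + b_i + c_i = 0`). -/
theorem soloBlind_triRep2_val (a b c : Fin d → H) (hsum : ∀ i, a i + b i + c i = 0) (i : Fin d)
    (x y : Fin 3) :
    soloBlindTriVal a b c i (soloBlindTriRep2 x y).1 + soloBlindTriVal a b c i (soloBlindTriRep2 x y).2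
      = soloBlindTriE a b i x + soloBlindTriE b a i y := by
  have hc : c i = -(a i) - b i := by
    have h : c i = -(a i + b i) := eq_neg_of_add_eq_zero_right (hsum i)
    rw [h]; abel
  fin_cases x <;> fin_cases y <;>
    (simp [soloBlindTriRep2, soloBlindTriVal, soloBlindTriE, hc]; try abel)

/-- **COVERING THEOREM.**  A good doubled family of `d` zero-sum triangles in a finite abelian group with
`|H| < 2·3^d` is PERFECT: every element of `H` is a rainbow sum (`Σ E_i + Σ E'_i = H` by pigeonhole, both
summands having `3^d` elements by T△² and its mirror). -/
theorem soloBlind_triangleDoubled_covering [Fintype H] (a b c : Fin d → H)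
    (hsum : ∀ i, a i + b i + c i = 0)
    (hgood : ∀ s t : Fin d → Option (Fin 3),
      (∑ i, (soloBlindTriVal a b c i (s i) + soloBlindTriVal a b c i (t i))) = 0 →
        ∀ i, s i = none ∧ t i = none)
    (hcard : Fintype.card H < 2 * 3 ^ d) (h : H) :
    ∃ s t : Fin d → Option (Fin 3),
      (∑ i, (soloBlindTriVal a b c i (s i) + soloBlindTriVal a b c i (t i))) = h := by
  classical
  have hsum' : ∀ i, b i + a i + c i = 0 := fun i => by rw [add_comm (b i) (a i)]; exact hsum i
  have hinj : Function.Injective (fun f : Fin d → Fin 3 => ∑ i, soloBlindTriE a b i (f i)) :=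
    soloBlind_triangleDoubled_injective a b c hsum hgood
  have hinj' : Function.Injective (fun g : Fin d → Fin 3 => ∑ i, soloBlindTriE b a i (g i)) :=
    soloBlind_triangleDoubled_injective b a c hsum' (soloBlind_triGood_swap a b c hgood)
  have hinjY : Function.Injective (fun g : Fin d → Fin 3 => h - ∑ i, soloBlindTriE b a i (g i)) := by
    intro g g' hgg
    apply hinj'
    have hgg' : h - ∑ i, soloBlindTriE b a i (g i) = h - ∑ i, soloBlindTriE b a i (g' i) := hgg
    simpa using hgg'
  set X := Finset.univ.image (fun f : Fin d → Fin 3 => ∑ i, soloBlindTriE a b i (f i)) with hX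
  set Y := Finset.univ.image (fun g : Fin d → Fin 3 => h - ∑ i, soloBlindTriE b a i (g i)) with hY
  have hXc : X.card = 3 ^ d := by
    rw [hX, Finset.card_image_of_injective _ hinj]
    simp [Finset.card_univ, Fintype.card_fin]
  have hYc : Y.card = 3 ^ d := by
    rw [hY, Finset.card_image_of_injective _ hinjY]
    simp [Finset.card_univ, Fintype.card_fin]
  have hnd : ¬ Disjoint X Y := by
    intro hdis
    have h1 := Finset.card_union_add_card_inter X Y
    have h2 : (X ∩ Y).card = 0 := by
      rw [Finset.disjoint_iff_inter_eq_empty.mp hdis]; rfl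
    have h3 : (X ∪ Y).card ≤ Fintype.card H := Finset.card_le_univ _
    omega
  obtain ⟨u, huX, huY⟩ := Finset.not_disjoint_iff.mp hnd
  obtain ⟨f, -, hf⟩ := Finset.mem_image.mp huX
  obtain ⟨g, -, hg⟩ := Finset.mem_image.mp huY
  have hfg : h - ∑ i, soloBlindTriE b a i (g i) = ∑ i, soloBlindTriE a b i (f i) := by
    rw [hg]; exact hf.symm
  refine ⟨fun i => (soloBlindTriRep2 (f i) (g i)).1, fun i => (soloBlindTriRep2 (f i) (g i)).2, ?_⟩
  simp only [soloBlind_triRep2_val a b c hsum, Finset.sum_add_distrib]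
  rw [← hfg, sub_add_cancel]

/-- **Conjecture T△ for `2d + 1` triangles, one of them simple.**  If a good doubled `d`-family stays good
after adjoining one more zero-sum triangle `{a', b', c'}` (used once), then `|H| ≥ 2·3^d` — the doubled
part cannot be perfect since `-a'` must not be one of its rainbow sums. -/
theorem soloBlind_triangleDoubled_plus_one_card [Fintype H] (a b c : Fin d → H)
    (hsum : ∀ i, a i + b i + c i = 0) (a' b' c' : H)
    (hgood1 : ∀ (s t : Fin d → Option (Fin 3)) (o : Option (Fin 3)),
      (∑ i, (soloBlindTriVal a b c i (s i) + soloBlindTriVal a b c i (t i))) + o.elim 0 ![a', b', c'] = 0 →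
        (∀ i, s i = none ∧ t i = none) ∧ o = none) :
    2 * 3 ^ d ≤ Fintype.card H := by
  by_contra hlt
  rw [not_le] at hlt
  have hgood : ∀ s t : Fin d → Option (Fin 3),
      (∑ i, (soloBlindTriVal a b c i (s i) + soloBlindTriVal a b c i (t i))) = 0 →
        ∀ i, s i = none ∧ t i = none := by
    intro s t hst
    exact (hgood1 s t none (by rw [hst]; simp)).1
  obtain ⟨s, t, hst⟩ := soloBlind_triangleDoubled_covering a b c hsum hgood hlt (-a')
  have h2 := (hgood1 s t (some 0) (by rw [hst]; simp)).2
  simp at h2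

end TriangleCovering

end Summit.MatrixMultiplication.MatrixMultiplication.Theorems
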